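import Literature.NumberTheory.Sieve.AletheiaZomleferFukshanskyGarcia2020Applications
import Literature.NumberTheory.Sieve.BatemanHornProofs
import HarnessLib

/-!
# Aletheia-Zomlefer–Fukshansky–Garcia (2020), §7.4: Cunningham chains from Bateman–Horn — proofs

Topic `Literature/NumberTheory/Sieve` (family `parity`, sub-problem `BatemanHorn`). Sibling proof
file of `AletheiaZomleferFukshanskyGarcia2020Applications.lean` for its §7.4 (the sibling
`AletheiaZomleferFukshanskyGarcia2020ApplicationsProofs.lean` holds the §7.2 discharges), kept
separate so that the applications file keeps its light imports: the discharge below needs the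
PROVED convergence theorem for the Bateman–Horn product, `exists_hasBatemanHornConst_holds`
(`BatemanHornProofs.lean`, Bateman–Horn, Math. Comp. 16 (1962), pp. 364–365 = Theorem 5.4.3 of
the source), whose import closure is heavy (Dedekind zeta functions). Everything here is PROVED
(no named facts, no `sorry`).

Source: S. L. Aletheia-Zomlefer, L. Fukshansky, S. R. Garcia, *The Bateman–Horn conjecture:
heuristics, history, and applications*, Expo. Math. 38 (2020) 430–479 = arXiv:1807.08899 (bib key
`AletheiaZomleferFukshanskyGarcia2020`; locators are those of arXiv v4), §7.4 "Cunningham chains":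
"The existence of arbitrary long Cunningham chains follows from the first Hardy–Littlewood
conjecture, and hence from Bateman–Horn conjecture. Indeed, let `f₁(t) = t`,
`f₂(t) = 2f₁(t) ± 1`, …, `f_k(t) = 2f_{k-1}(t) ± 1`, then we need them all to be prime
simultaneously. Bateman–Horn guarantees the existence of infinitely many such `k`-tuples and even
gives an asymptotic estimate on the growth of their number".

## Contents

* `BatemanHornConjecture.tendsto_polyPrimeCount_atTop`,
  `BatemanHornConjecture.setOf_forall_prime_infinite` — the qualitative content of the
  conjecture: under Bateman–Horn, for EVERY Bateman–Horn system `f₁, …, f_k` the count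
  `Q(f; x) → ∞`, so infinitely many `n` make all `fᵢ(n)` prime. The one non-formal point of the
  source's sentence is that the constant `C(f₁, …, f_k)` of the asymptotic is positive; here this
  is the PROVED `exists_hasBatemanHornConst_holds` (the Euler product of a Bateman–Horn system
  converges to a positive limit) combined with uniqueness of limits in `ℝ`.
* `cunninghamSystem n` — the system `fᵢ(t) = 2ⁱ t + (2ⁱ - 1)`, `i < n`, of §7.4 (first kind),
  with `fᵢ(q) = cunninghamTerm q i` (`cunninghamSystem_eval_natCast`) and
  `Q(cunninghamSystem n; x) = #{q ≤ x : q starts a Cunningham chain of length n}`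
  (`polyPrimeCount_cunninghamSystem`).
* `isBatemanHornSystem_cunninghamSystem` — the system satisfies the Bateman–Horn hypotheses
  (implicit in the source): each `fᵢ` is primitive of degree one, hence irreducible, with leading
  coefficient `2ⁱ > 0`; `fᵢ`, `fⱼ` are not associated for `i ≠ j` (units of `ℤ[t]` are `±1` and
  `2ⁱ ≠ ±2ʲ`); and there is no fixed prime divisor since `fᵢ(p - 1) = 2ⁱ p - 1 ≡ -1 (mod p)` for
  every prime `p`, so `ω_f(p) ≤ p - 1`.
* `isCunninghamChain_infinite_of_batemanHorn_holds` — DISCHARGE of the named fact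
  `isCunninghamChain_infinite_of_batemanHorn` of the applications file.
-/

noncomputable section

open Filter Finset Polynomial Asymptotics
open scoped Topology

namespace Literature.NumberTheory.Sieve

/-! ### Bateman–Horn ⇒ infinitely many simultaneous prime values -/

/-- `x / (log x)^k → +∞` along the natural numbers, from Mathlib's `(log x)^k = o(x)`
(`Real.isLittleO_pow_log_id_atTop`). The cases `k = 1, 2` are the applications file's
`tendsto_natCast_div_log_atTop`, `tendsto_natCast_div_log_sq_atTop`; the general case is also
`tendsto_natCast_div_log_pow_atTop` of `HardyLittlewoodProofs.lean`, not imported here to keep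
the import closure of this file small. [folklore] -/
private theorem tendsto_natCast_div_log_pow_atTop' (k : ℕ) :
    Tendsto (fun x : ℕ ↦ (x : ℝ) / Real.log x ^ k) atTop atTop := by
  have h1 : Tendsto (fun x : ℝ ↦ Real.log x ^ k / x) atTop (𝓝 0) := by
    simpa using (Real.isLittleO_pow_log_id_atTop (n := k)).tendsto_div_nhds_zero
  have h2 : Tendsto (fun x : ℝ ↦ Real.log x ^ k / x) atTop (𝓝[>] 0) := by
    refine tendsto_nhdsWithin_iff.mpr ⟨h1, ?_⟩
    filter_upwards [eventually_gt_atTop 1] with x hx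
    exact div_pos (pow_pos (Real.log_pos hx) k) (by linarith)
  refine ((h2.inv_tendsto_nhdsGT_zero).comp tendsto_natCast_atTop_atTop).congr fun x ↦ ?_
  simp [inv_div]

/-- Under the Bateman–Horn conjecture, `Q(f₁, …, f_k; x) → ∞` for every Bateman–Horn system: the
constant `C` of the conjectured asymptotic `Q ∼ C/(∏ deg fᵢ) · x/(log x)^k` is the ordered limit
of the Euler product, which is positive by the PROVED convergence theorem
`exists_hasBatemanHornConst_holds` (Bateman–Horn 1962, pp. 364–365; Theorem 5.4.3 of the source)
and uniqueness of limits; `∏ deg fᵢ > 0` (`IsBatemanHornSystem.natDegree_pos`) and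
`x/(log x)^k → ∞`. [cite: AletheiaZomleferFukshanskyGarcia2020, §5.4 Theorem 5.4.3 with (3.6.2)] -/
theorem BatemanHornConjecture.tendsto_polyPrimeCount_atTop (hBH : BatemanHornConjecture) {k : ℕ}
    {f : Fin k → ℤ[X]} (hf : IsBatemanHornSystem f) :
    Tendsto (fun x : ℕ ↦ (polyPrimeCount f x : ℝ)) atTop atTop := by
  obtain ⟨C, hC, hQ⟩ := hBH k f hf
  obtain ⟨C', hC'pos, hC'⟩ := exists_hasBatemanHornConst_holds hf
  have hCeq : C = C' := tendsto_nhds_unique hC hC'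
  have hprod : 0 < ∏ i, ((f i).natDegree : ℝ) :=
    prod_pos fun i _ ↦ by exact_mod_cast hf.natDegree_pos i
  refine hQ.symm.tendsto_atTop ?_
  have := (tendsto_natCast_div_log_pow_atTop' k).const_mul_atTop (div_pos (hCeq ▸ hC'pos) hprod)
  simpa [mul_div_assoc] using this

/-- Hence, under the Bateman–Horn conjecture, every Bateman–Horn system `f₁, …, f_k` takes
simultaneously (positive) prime values at infinitely many `n ∈ ℕ` ("Bateman–Horn guarantees the
existence of infinitely many such `k`-tuples", §7.4 of the source; the qualitative
Schinzel-type conclusion). [cite: AletheiaZomleferFukshanskyGarcia2020, §7.4 (infinitely many k-tuples from Bateman–Horn)] -/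
theorem BatemanHornConjecture.setOf_forall_prime_infinite (hBH : BatemanHornConjecture) {k : ℕ}
    {f : Fin k → ℤ[X]} (hf : IsBatemanHornSystem f) :
    {n : ℕ | ∀ i, 0 < (f i).eval (n : ℤ) ∧ ((f i).eval (n : ℤ)).toNat.Prime}.Infinite := by
  intro hfin
  have hle : ∀ x, (polyPrimeCount f x : ℝ) ≤ hfin.toFinset.card := fun x ↦ by
    unfold polyPrimeCount
    exact_mod_cast card_le_card fun n hn ↦ hfin.mem_toFinset.2 (mem_filter.1 hn).2
  obtain ⟨x, hx⟩ := ((hBH.tendsto_polyPrimeCount_atTop hf).eventually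
    (eventually_gt_atTop (hfin.toFinset.card : ℝ))).exists
  exact not_lt.2 (hle x) hx

/-! ### §7.4 — the Cunningham system -/

/-- The Cunningham system of length `n` of §7.4 (first kind): `f₁ = t`, `f_{i+1} = 2fᵢ + 1`,
i.e. (0-indexed) `fᵢ(t) = 2ⁱ t + (2ⁱ - 1)` for `i < n`.
[cite: AletheiaZomleferFukshanskyGarcia2020, §7.4 (f₁ = t, f_{i+1} = 2fᵢ + 1)] -/
def cunninghamSystem (n : ℕ) : Fin n → ℤ[X] :=
  fun i ↦ C (2 ^ (i : ℕ)) * X + C (2 ^ (i : ℕ) - 1)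

/-- `fᵢ(x) = 2ⁱ x + (2ⁱ - 1)`. [cite: AletheiaZomleferFukshanskyGarcia2020, §7.4] -/
theorem cunninghamSystem_eval (n : ℕ) (i : Fin n) (x : ℤ) :
    (cunninghamSystem n i).eval x = 2 ^ (i : ℕ) * x + (2 ^ (i : ℕ) - 1) := by
  simp [cunninghamSystem]

/-- `fᵢ(q) = cᵢ(q) = 2ⁱ q + (2ⁱ - 1)`, the `i`-th term of the Cunningham chain started at `q`
(`cunninghamTerm`, `cunninghamTerm_add_one`).
[cite: AletheiaZomleferFukshanskyGarcia2020, §7.4 (p_{i+1} = 2ⁱ p₁ + (2ⁱ - 1))] -/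
theorem cunninghamSystem_eval_natCast (n : ℕ) (i : Fin n) (q : ℕ) :
    (cunninghamSystem n i).eval (q : ℤ) = cunninghamTerm q i := by
  have h : ((cunninghamTerm q i : ℕ) : ℤ) + 1 = 2 ^ (i : ℕ) * ((q : ℤ) + 1) := by
    exact_mod_cast cunninghamTerm_add_one q i
  rw [cunninghamSystem_eval]
  linear_combination (-1 : ℤ) * h

/-- `q` is counted by `Q(cunninghamSystem n; ·)` (every `fᵢ(q)`, `i < n`, is a positive prime)
iff `q` starts a Cunningham chain of length `n`. [cite: AletheiaZomleferFukshanskyGarcia2020, §7.4] -/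
theorem forall_cunninghamSystem_prime_iff (n q : ℕ) :
    (∀ i : Fin n, 0 < (cunninghamSystem n i).eval (q : ℤ) ∧
      ((cunninghamSystem n i).eval (q : ℤ)).toNat.Prime) ↔ IsCunninghamChain q n := by
  simp only [cunninghamSystem_eval_natCast, Int.toNat_natCast]
  constructor
  · intro h i hi
    exact (h ⟨i, hi⟩).2
  · intro h i
    exact ⟨by exact_mod_cast (h i i.isLt).pos, h i i.isLt⟩

open Classical in
/-- `Q(cunninghamSystem n; x) = #{q ≤ x : q, 2q+1, …, (n terms) all prime}`, the number of
Cunningham chains (of the first kind) of length `n` starting at some `q ≤ x` (classical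
decidability on the right). [cite: AletheiaZomleferFukshanskyGarcia2020, §7.4] -/
theorem polyPrimeCount_cunninghamSystem (n x : ℕ) :
    polyPrimeCount (cunninghamSystem n) x = #{q ∈ range (x + 1) | IsCunninghamChain q n} := by
  unfold polyPrimeCount
  congr 1
  ext q
  simp only [mem_filter, forall_cunninghamSystem_prime_iff]

/-- The constant coefficient of `fᵢ` is `2ⁱ - 1`. [folklore] -/
theorem cunninghamSystem_coeff_zero (n : ℕ) (i : Fin n) :
    (cunninghamSystem n i).coeff 0 = 2 ^ (i : ℕ) - 1 := by
  show (C (2 ^ (i : ℕ)) * X + C (2 ^ (i : ℕ) - 1) : ℤ[X]).coeff 0 = _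
  rw [coeff_add, coeff_C_mul, coeff_X_zero, mul_zero, zero_add, coeff_C_zero]

/-- The coefficient of `t` in `fᵢ` is `2ⁱ`. [folklore] -/
theorem cunninghamSystem_coeff_one (n : ℕ) (i : Fin n) :
    (cunninghamSystem n i).coeff 1 = 2 ^ (i : ℕ) := by
  show (C (2 ^ (i : ℕ)) * X + C (2 ^ (i : ℕ) - 1) : ℤ[X]).coeff 1 = _
  rw [coeff_add, coeff_C_mul, coeff_X_one, mul_one, coeff_C_of_ne_zero one_ne_zero, add_zero]

/-- `2ⁱ t + (2ⁱ - 1)` is irreducible in `ℤ[t]`: it is primitive (a common divisor of the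
coefficients `2ⁱ` and `2ⁱ - 1` divides `1`) of degree one over `ℚ` (Gauss's lemma). [folklore] -/
theorem irreducible_cunninghamSystem (n : ℕ) (i : Fin n) : Irreducible (cunninghamSystem n i) := by
  have h2 : (2 : ℤ) ^ (i : ℕ) ≠ 0 := pow_ne_zero _ two_ne_zero
  have hprim : (cunninghamSystem n i).IsPrimitive := by
    rw [isPrimitive_iff_isUnit_of_C_dvd]
    intro r hr
    have h0 := (C_dvd_iff_dvd_coeff r _).mp hr 0
    have h1 := (C_dvd_iff_dvd_coeff r _).mp hr 1
    rw [cunninghamSystem_coeff_zero] at h0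
    rw [cunninghamSystem_coeff_one] at h1
    refine isUnit_of_dvd_one ?_
    have := dvd_sub h1 h0
    rwa [sub_sub_cancel] at this
  rw [hprim.irreducible_iff_irreducible_map_fraction_map (K := ℚ)]
  refine irreducible_of_degree_eq_one ?_
  rw [degree_map_eq_of_injective (algebraMap ℤ ℚ).injective_int]
  exact degree_linear h2

/-- **§7.4 (implicit)**: the Cunningham system satisfies the hypotheses of the Bateman–Horn
conjecture — irreducible members with leading coefficients `2ⁱ > 0`, pairwise non-associated
(the units of `ℤ[t]` are `±1` and `2ⁱ ≠ ±2ʲ` for `i ≠ j`), and no fixed prime divisor: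
`fᵢ(p - 1) = 2ⁱ p - 1 ≡ -1 (mod p)`, so `p - 1` is never a root of `∏ fᵢ` modulo `p` and
`ω_f(p) ≤ p - 1 < p`. [cite: AletheiaZomleferFukshanskyGarcia2020, §7.4 (the system f₁ = t, f_{i+1} = 2fᵢ + 1)] -/
theorem isBatemanHornSystem_cunninghamSystem (n : ℕ) :
    IsBatemanHornSystem (cunninghamSystem n) where
  irreducible := irreducible_cunninghamSystem n
  leadingCoeff_pos i := by
    show 0 < (C (2 ^ (i : ℕ)) * X + C (2 ^ (i : ℕ) - 1) : ℤ[X]).leadingCoeff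
    rw [leadingCoeff_linear (pow_ne_zero _ two_ne_zero)]
    positivity
  pairwise_not_associated := by
    intro i j hij hassoc
    obtain ⟨u, hu⟩ := hassoc
    obtain ⟨r, hr, hru⟩ := Polynomial.isUnit_iff.mp u.isUnit
    have h1 := congrArg (fun g : ℤ[X] ↦ g.coeff 1) hu
    simp only [← hru, coeff_mul_C, cunninghamSystem_coeff_one] at h1
    rcases Int.isUnit_iff.mp hr with rfl | rfl
    · refine hij (Fin.ext ?_)
      rw [mul_one] at h1
      exact Int.pow_right_injective (a := 2) (by decide) h1
    · have hi : (0 : ℤ) < 2 ^ (i : ℕ) := by positivity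
      have hj : (0 : ℤ) < 2 ^ (j : ℕ) := by positivity
      linarith
  hasNoFixedPrimeDivisor p hp := by
    have hpZ : _root_.Prime (p : ℤ) := Nat.prime_iff_prime_int.mp hp
    unfold polyRootCountMod
    calc #((range p).filter fun m : ℕ ↦ (p : ℤ) ∣ ∏ i, (cunninghamSystem n i).eval (m : ℤ))
        < #(range p) := by
          refine card_lt_card (filter_ssubset.mpr ⟨p - 1, mem_range.mpr (Nat.sub_lt hp.pos one_pos), ?_⟩)
          refine hpZ.not_dvd_finsetProd fun i _ hi ↦ ?_
          rw [cunninghamSystem_eval, Nat.cast_sub hp.one_le, Nat.cast_one] at hi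
          refine hpZ.not_dvd_one ?_
          have := dvd_sub (dvd_mul_left (p : ℤ) (2 ^ (i : ℕ))) hi
          convert this using 1
          ring
      _ = p := card_range p

/-! ### §7.4 — the discharge -/

/-- **§7.4 discharged**: the Bateman–Horn conjecture implies that for every `n` there are
infinitely many Cunningham chains (of the first kind) of length `n` — apply the conjecture to the
Bateman–Horn system `fᵢ(t) = 2ⁱ t + (2ⁱ - 1)`, `i < n` (`isBatemanHornSystem_cunninghamSystem`),
whose constant is positive by the proved convergence of the Bateman–Horn product, so that
`Q → ∞` and the `q` with `f₀(q), …, f_{n-1}(q)` all prime, i.e. the starting points of chains of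
length `n`, form an infinite set.
[cite: AletheiaZomleferFukshanskyGarcia2020, §7.4 (chains from Bateman–Horn)] -/
theorem isCunninghamChain_infinite_of_batemanHorn_holds :
    isCunninghamChain_infinite_of_batemanHorn := by
  intro hBH n
  refine ((hBH.setOf_forall_prime_infinite (isBatemanHornSystem_cunninghamSystem n)).mono
    fun q hq ↦ ?_)
  exact (forall_cunninghamSystem_prime_iff n q).mp hq

end Literature.NumberTheory.Sieve

end
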